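import Literature.Analysis.FluidPDE.PassiveScalarShearFibreDamping
import Summits.AnomalousDissipation.AnomalousDissipation.Theorems.SawtoothPulseCascadeK1LocalisedCascadeSmoothLeakage

/-!
# K1loc, line `Spectral` / SeqCone — helper: the COMMUTATOR `[m(D), Θ]` and the CROSS TERMS of separated strips

Third Fourier helper file of the first prover lane on the crux `K1LocalisedCascade` (stmt-AnomalousDissipation-19491),
route `SawtoothPulseCascade` (architecture memo `K1loc-architecture-findings-k1locp1.md`, finding F-a).  The per-half-pulse
step of the line splits the (gauged) fibre `G` as `Θ⁺G + Θ⁻G + ψ_Z G` along the two slope families of the rounded sawtooth,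
whose localisers `Θ⁺, Θ⁻` have DISJOINT supports.  Energies of a smooth spectral cut-off `m(D)` then add up to a cross term
`⟨m(D)(Θ⁺G), m(D)(Θ⁻G)⟩ = ⟨[m(D)², Θ⁺]G, Θ⁻G⟩ + ⟨Θ⁺·m(D)²G, Θ⁻G⟩`, whose second summand VANISHES by disjointness and whose
first is a commutator.  This file records, on `T^d = UnitAddTorus d` and in the tree's vocabulary:

* `sqrt_tsum_sq_commutator_le` — **commutator estimate** `‖m(D)(ΘF) − Θ·(m(D)F)‖_{ℓ²} ≤ (∑ₙ ω n ‖𝓕Θ n‖)·‖F‖_{L²}` for a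
  bounded real symbol `m` with modulus `ω` (`|m k − m (k−n)| ≤ ω n`), `F, Θ` continuous with summable coefficients (no bound
  on `|Θ|` needed); here `m(D)F` is the synthesis of `m · 𝓕F` (`Torus.fourierSynth`);
* `tsum_conj_mFourierCoeff_mul_eq_zero_of_disjoint` — `∑ₖ conj(𝓕(Θ₁H)(k)) 𝓕(Θ₂G)(k) = 0` when `conj(Θ₁)·Θ₂ = 0` pointwise
  (polarised Parseval `Torus.hasSum_conj_mFourierCoeff_mul_of_continuous`);
* `norm_tsum_symbol_sq_cross_le` — **cross-term bound** `|∑ₖ m_k² 𝓕(Θ₁G)(k) conj(𝓕(Θ₂G)(k))| ≤ (∑ₙ ω₂ n ‖𝓕Θ₁ n‖)·∫‖G‖²`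
  for disjointly supported `Θ₁, Θ₂` with `|Θ₂| ≤ 1` and a modulus `ω₂` of `m²`.

WHAT THIS IS NOT: no statement about the cascade or the stub itself; a line-independent Fourier tool.
[cite: Grafakos2014, Prop. 3.1.2 (5) (coefficients of products) and Prop. 3.2.7 (3) (Parseval)] [problem: turb]
-/

-- `Summit.<Summit>.<Problem>`: single-conjunct summit, the duplicate namespace segment is deliberate.
set_option linter.dupNamespace false

noncomputable section

namespace Summit.AnomalousDissipation.AnomalousDissipation.Theorems.SawtoothPulseCascade.SpectralLeakage

open MeasureTheory Set Filter Topology UnitAddTorus Complex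
open scoped ENNReal NNReal ComplexConjugate
open Literature.Analysis Literature.Analysis.FunctionSpaces Literature.Analysis.FluidPDE
open Literature.Analysis.FunctionSpaces.Torus
open Literature.Analysis.FluidPDE.ScalarFourier (lconv lconv_apply)

variable {d : Type*} [Fintype d]

/-! ## §1 The commutator `[m(D), Θ]` -/

/-- **Commutator estimate.**  For `F, Θ : T^d → ℂ` continuous with absolutely summable Fourier coefficients, a real symbol
`m` with `|m| ≤ M` and modulus `ω ≥ 0` (`|m k − m (k−n)| ≤ ω n`, `∑ₙ ω n ‖𝓕Θ n‖ < ∞`), and `H = ∑ₖ e_k (m k) 𝓕F(k)`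
the synthesis of `m · 𝓕F` ("`m(D)F`"):
`√(∑ₖ ‖m k · 𝓕(ΘF)(k) − 𝓕(Θ H)(k)‖²) ≤ (∑ₙ ω n ‖𝓕Θ n‖) · √(∫‖F‖²)`, i.e. `‖[m(D), Θ]F‖ ≤ (∑ ω|𝓕Θ|)‖F‖`.
[cite: Grafakos2014, Prop. 3.1.2 (5) (coefficients of products are lattice convolutions) and Prop. 3.2.7 (3) (Parseval)] -/
theorem sqrt_tsum_sq_commutator_le {F Θ : UnitAddTorus d → ℂ} (hF : Continuous F)
    (hFs : Summable fun k => ‖mFourierCoeff F k‖) (hΘ : Continuous Θ)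
    (hΘs : Summable fun k => ‖mFourierCoeff Θ k‖)
    {m : (d → ℤ) → ℝ} {M : ℝ} (hmM : ∀ k, |m k| ≤ M) {ω : (d → ℤ) → ℝ} (hω0 : ∀ n, 0 ≤ ω n)
    (hω : ∀ k n, |m k - m (k - n)| ≤ ω n) (hωs : Summable fun n => ω n * ‖mFourierCoeff Θ n‖) :
    (Summable fun k => ‖(m k : ℂ) * mFourierCoeff (fun x => Θ x * F x) k -
        mFourierCoeff (fun x => Θ x * fourierSynth (fun k => (m k : ℂ) * mFourierCoeff F k) x) k‖ ^ 2) ∧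
    Real.sqrt (∑' k, ‖(m k : ℂ) * mFourierCoeff (fun x => Θ x * F x) k -
        mFourierCoeff (fun x => Θ x * fourierSynth (fun k => (m k : ℂ) * mFourierCoeff F k) x) k‖ ^ 2) ≤
      (∑' n, ω n * ‖mFourierCoeff Θ n‖) * Real.sqrt (∫ x, ‖F x‖ ^ 2) := by
  classical
  set c : (d → ℤ) → ℂ := mFourierCoeff Θ with hc_def
  set f : (d → ℤ) → ℂ := mFourierCoeff F with hf_def
  have hM0 : 0 ≤ M := (abs_nonneg _).trans (hmM 0)
  have hB1 : ∀ j, ‖f j‖ ≤ ∑' i, ‖f i‖ := norm_le_tsum_norm hFs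
  set B₁ : ℝ := ∑' i, ‖f i‖ with hB₁_def
  -- the synthesis `H` of `m f`
  set h : (d → ℤ) → ℂ := fun k => (m k : ℂ) * f k with hh_def
  have hh : Summable fun k => ‖h k‖ :=
    (hFs.mul_left M).of_nonneg_of_le (fun _ => norm_nonneg _) fun k => by
      rw [hh_def, norm_mul, Complex.norm_real, Real.norm_eq_abs]
      exact mul_le_mul_of_nonneg_right (hmM k) (norm_nonneg _)
  have hH_c : Continuous (fourierSynth h) := continuous_fourierSynth hh
  have hH_coeff : ∀ k, mFourierCoeff (fourierSynth h) k = h k := mFourierCoeff_fourierSynth hh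
  -- product coefficients
  have hprod : ∀ k, mFourierCoeff (fun x => Θ x * F x) k = ∑' n, c n * f (k - n) := fun k => by
    rw [ScalarFourier.mFourierCoeff_mul hΘ hΘs hF k, lconv_apply]
  have hP : ∀ k, mFourierCoeff (fun x => Θ x * fourierSynth h x) k = ∑' n, c n * ((m (k - n) : ℂ) * f (k - n)) :=
    fun k => by
    rw [ScalarFourier.mFourierCoeff_mul hΘ hΘs hH_c k, lconv_apply]
    refine tsum_congr fun n => ?_
    rw [hH_coeff]
  -- summability of the pieces (bounded × summable)
  have hsP : ∀ k, Summable fun n => c n * ((m (k - n) : ℂ) * f (k - n)) := fun k =>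
    .of_norm <| (hΘs.mul_right (M * B₁)).of_nonneg_of_le (fun _ => norm_nonneg _) fun n => by
      rw [norm_mul, norm_mul, Complex.norm_real, Real.norm_eq_abs]
      exact mul_le_mul_of_nonneg_left (mul_le_mul (hmM _) (hB1 _) (norm_nonneg _) hM0) (norm_nonneg _)
  have hsR : ∀ k, Summable fun n => c n * (((m k - m (k - n) : ℝ) : ℂ) * f (k - n)) := fun k =>
    .of_norm <| ((hωs.mul_right B₁)).of_nonneg_of_le (fun _ => norm_nonneg _) fun n => by
      rw [norm_mul, norm_mul, Complex.norm_real, Real.norm_eq_abs]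
      calc ‖c n‖ * (|m k - m (k - n)| * ‖f (k - n)‖) ≤ ‖c n‖ * (ω n * B₁) :=
            mul_le_mul_of_nonneg_left (mul_le_mul (hω k n) (hB1 _) (norm_nonneg _) (hω0 n)) (norm_nonneg _)
        _ = ω n * ‖c n‖ * B₁ := by ring
  have hs1 : ∀ k, Summable fun n => (m k : ℂ) * (c n * f (k - n)) := fun k =>
    Summable.mul_left _ <| .of_norm <| (hΘs.mul_right B₁).of_nonneg_of_le (fun _ => norm_nonneg _) fun n => by
      rw [norm_mul]; exact mul_le_mul_of_nonneg_left (hB1 _) (norm_nonneg _)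
  -- the commutator coefficient `R k`
  set R : (d → ℤ) → ℂ := fun k => ∑' n, c n * (((m k - m (k - n) : ℝ) : ℂ) * f (k - n)) with hR_def
  have hsplit : ∀ k, (m k : ℂ) * mFourierCoeff (fun x => Θ x * F x) k -
      mFourierCoeff (fun x => Θ x * fourierSynth h x) k = R k := fun k => by
    rw [hprod k, hP k, ← tsum_mul_left, ← (hs1 k).tsum_sub (hsP k), hR_def]
    refine tsum_congr fun n => ?_
    push_cast
    ring
  -- Parseval for `F` and the shifted Tonelli identity
  have hParsF := hasSum_sq_mFourierCoeff_of_continuous hF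
  set A : ℝ := ∑' n, ω n * ‖c n‖ with hA_def
  have hA0 : 0 ≤ A := tsum_nonneg fun n => mul_nonneg (hω0 n) (norm_nonneg _)
  obtain ⟨hTon1, hTon2, hTon3⟩ := tsum_tsum_mul_shift (a := fun n => ω n * ‖c n‖) (φ := fun k => ‖f k‖ ^ 2)
    (fun n => mul_nonneg (hω0 n) (norm_nonneg _)) (fun k => sq_nonneg _) hωs hParsF.summable
  -- pointwise weighted Cauchy–Schwarz
  have hR_pt : ∀ k, ‖R k‖ ^ 2 ≤ A * ∑' n, ω n * ‖c n‖ * ‖f (k - n)‖ ^ 2 := fun k => by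
    have hr0 : ∀ n, 0 ≤ ω n * ‖c n‖ * ‖f (k - n)‖ := fun n =>
      mul_nonneg (mul_nonneg (hω0 n) (norm_nonneg _)) (norm_nonneg _)
    have hCS := tsum_sq_le_tsum_mul_tsum (r := fun n => ω n * ‖c n‖ * ‖f (k - n)‖)
      (f := fun n => ω n * ‖c n‖) (g := fun n => ω n * ‖c n‖ * ‖f (k - n)‖ ^ 2) hr0
      (fun n => mul_nonneg (hω0 n) (norm_nonneg _)) (fun n => mul_nonneg (mul_nonneg (hω0 n) (norm_nonneg _))
        (sq_nonneg _)) hωs (hTon1 k) (fun n => le_of_eq (by ring))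
    have hRle : ‖R k‖ ≤ ∑' n, ω n * ‖c n‖ * ‖f (k - n)‖ := by
      rw [hR_def]
      refine (norm_tsum_le_tsum_norm (hsR k).norm).trans ?_
      refine (hsR k).norm.tsum_le_tsum (fun n => ?_) hCS.1
      rw [norm_mul, norm_mul, Complex.norm_real, Real.norm_eq_abs]
      calc ‖c n‖ * (|m k - m (k - n)| * ‖f (k - n)‖) ≤ ‖c n‖ * (ω n * ‖f (k - n)‖) :=
            mul_le_mul_of_nonneg_left (mul_le_mul_of_nonneg_right (hω k n) (norm_nonneg _)) (norm_nonneg _)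
        _ = ω n * ‖c n‖ * ‖f (k - n)‖ := by ring
    calc ‖R k‖ ^ 2 ≤ (∑' n, ω n * ‖c n‖ * ‖f (k - n)‖) ^ 2 := pow_le_pow_left₀ (norm_nonneg _) hRle 2
      _ ≤ A * ∑' n, ω n * ‖c n‖ * ‖f (k - n)‖ ^ 2 := hCS.2
  have hRs : Summable fun k => ‖R k‖ ^ 2 :=
    (hTon2.mul_left A).of_nonneg_of_le (fun _ => sq_nonneg _) hR_pt
  have hR_le : ∑' k, ‖R k‖ ^ 2 ≤ A ^ 2 * ∫ x, ‖F x‖ ^ 2 :=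
    calc ∑' k, ‖R k‖ ^ 2 ≤ ∑' k, A * ∑' n, ω n * ‖c n‖ * ‖f (k - n)‖ ^ 2 :=
          hRs.tsum_le_tsum hR_pt (hTon2.mul_left A)
      _ = A * (A * ∑' k, ‖f k‖ ^ 2) := by rw [tsum_mul_left, hTon3]
      _ = A ^ 2 * ∫ x, ‖F x‖ ^ 2 := by rw [hParsF.tsum_eq]; ring
  simp_rw [hsplit]
  refine ⟨hRs, ?_⟩
  calc Real.sqrt (∑' k, ‖R k‖ ^ 2) ≤ Real.sqrt (A ^ 2 * ∫ x, ‖F x‖ ^ 2) := Real.sqrt_le_sqrt hR_le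
    _ = A * Real.sqrt (∫ x, ‖F x‖ ^ 2) := by
        rw [Real.sqrt_mul' _ (integral_nonneg fun x => by positivity), Real.sqrt_sq hA0]

/-! ## §2 Disjoint localisers: the main term vanishes, the cross term is a commutator -/

/-- **Orthogonality of disjointly localised products**: if `conj(Θ₁ x) · Θ₂ x = 0` for all `x` (disjoint supports) then
`∑ₖ conj(𝓕(Θ₁H)(k)) 𝓕(Θ₂G)(k) = 0` for continuous `H, G, Θ₁, Θ₂` (polarised Parseval).
[cite: Grafakos2014, Prop. 3.2.7 (3) (Parseval)] -/
theorem tsum_conj_mFourierCoeff_mul_eq_zero_of_disjoint {Θ₁ Θ₂ H G : UnitAddTorus d → ℂ} (hΘ₁ : Continuous Θ₁)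
    (hΘ₂ : Continuous Θ₂) (hH : Continuous H) (hG : Continuous G) (hdis : ∀ x, conj (Θ₁ x) * Θ₂ x = 0) :
    ∑' k, conj (mFourierCoeff (fun x => Θ₁ x * H x) k) * mFourierCoeff (fun x => Θ₂ x * G x) k = 0 := by
  have h := Literature.Analysis.FluidPDE.Torus.hasSum_conj_mFourierCoeff_mul_of_continuous
    (f := fun x => Θ₁ x * H x) (g := fun x => Θ₂ x * G x) (hΘ₁.mul hH) (hΘ₂.mul hG)
  rw [h.tsum_eq]
  refine (integral_congr_ae (ae_of_all _ fun x => ?_)).trans (integral_zero _ _)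
  show conj (Θ₁ x * H x) * (Θ₂ x * G x) = (0 : ℂ)
  rw [map_mul, show conj (Θ₁ x) * conj (H x) * (Θ₂ x * G x) = (conj (Θ₁ x) * Θ₂ x) * (conj (H x) * G x) by ring,
    hdis x, zero_mul]

omit [Fintype d] in
/-- Cauchy–Schwarz for `∑ₖ uₖ conj(vₖ)` with square-summable families. [folklore] -/
theorem norm_tsum_mul_conj_le {u v : (d → ℤ) → ℂ} (hu : Summable fun k => ‖u k‖ ^ 2)
    (hv : Summable fun k => ‖v k‖ ^ 2) :
    (Summable fun k => u k * conj (v k)) ∧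
      ‖∑' k, u k * conj (v k)‖ ≤ Real.sqrt (∑' k, ‖u k‖ ^ 2) * Real.sqrt (∑' k, ‖v k‖ ^ 2) := by
  have hCS := tsum_sq_le_tsum_mul_tsum (r := fun k => ‖u k‖ * ‖v k‖) (f := fun k => ‖u k‖ ^ 2)
    (g := fun k => ‖v k‖ ^ 2) (fun k => mul_nonneg (norm_nonneg _) (norm_nonneg _)) (fun k => sq_nonneg _)
    (fun k => sq_nonneg _) hu hv (fun k => le_of_eq (by ring))
  have hs : Summable fun k => u k * conj (v k) :=
    .of_norm <| hCS.1.of_nonneg_of_le (fun _ => norm_nonneg _) fun k => by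
      rw [norm_mul, RCLike.norm_conj]
  refine ⟨hs, ?_⟩
  have h1 : ‖∑' k, u k * conj (v k)‖ ≤ ∑' k, ‖u k‖ * ‖v k‖ := by
    refine (norm_tsum_le_tsum_norm hs.norm).trans (le_of_eq (tsum_congr fun k => ?_))
    rw [norm_mul, RCLike.norm_conj]
  have h0 : 0 ≤ ∑' k, ‖u k‖ * ‖v k‖ := tsum_nonneg fun k => mul_nonneg (norm_nonneg _) (norm_nonneg _)
  have h2 : ∑' k, ‖u k‖ * ‖v k‖ ≤ Real.sqrt (∑' k, ‖u k‖ ^ 2) * Real.sqrt (∑' k, ‖v k‖ ^ 2) := by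
    rw [← Real.sqrt_mul (tsum_nonneg fun k => sq_nonneg _)]
    exact Real.le_sqrt_of_sq_le hCS.2
  exact h1.trans h2

/-- **Cross-term bound for disjoint localisers.**  Let `G, Θ₁ : T^d → ℂ` be continuous with absolutely summable
coefficients, `Θ₂` continuous with `‖Θ₂‖ ≤ 1`, `conj(Θ₁)·Θ₂ = 0` pointwise (disjoint supports), and let `m` be a real symbol with `|m| ≤ M` whose
SQUARE has modulus `ω₂` (`|m k² − m (k−n)²| ≤ ω₂ n`, `∑ₙ ω₂ n ‖𝓕Θ₁ n‖ < ∞`).  Then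
`|∑ₖ m_k² 𝓕(Θ₁G)(k) conj(𝓕(Θ₂G)(k))| ≤ (∑ₙ ω₂ n ‖𝓕Θ₁ n‖) · ∫‖G‖²`:
the energies `‖m(D)(Θ₁G)‖² + ‖m(D)(Θ₂G)‖²` account for `‖m(D)((Θ₁+Θ₂)G)‖²` up to twice this (real part), because
`⟨Θ₁ · m(D)²G, Θ₂G⟩ = 0` exactly and the rest is the commutator `[m(D)², Θ₁]`.
[cite: Grafakos2014, Prop. 3.1.2 (5) and Prop. 3.2.7 (3)] -/
theorem norm_tsum_symbol_sq_cross_le {G Θ₁ Θ₂ : UnitAddTorus d → ℂ} (hG : Continuous G)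
    (hGs : Summable fun k => ‖mFourierCoeff G k‖) (hΘ₁ : Continuous Θ₁)
    (hΘ₁s : Summable fun k => ‖mFourierCoeff Θ₁ k‖) (hΘ₂ : Continuous Θ₂) (hΘ₂1 : ∀ x, ‖Θ₂ x‖ ≤ 1)
    (hdis : ∀ x, conj (Θ₁ x) * Θ₂ x = 0)
    {m : (d → ℤ) → ℝ} {M : ℝ} (hmM : ∀ k, |m k| ≤ M) {ω₂ : (d → ℤ) → ℝ} (hω0 : ∀ n, 0 ≤ ω₂ n)
    (hω : ∀ k n, |m k ^ 2 - m (k - n) ^ 2| ≤ ω₂ n) (hωs : Summable fun n => ω₂ n * ‖mFourierCoeff Θ₁ n‖) :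
    ‖∑' k, ((m k ^ 2 : ℝ) : ℂ) * mFourierCoeff (fun x => Θ₁ x * G x) k *
        conj (mFourierCoeff (fun x => Θ₂ x * G x) k)‖ ≤
      (∑' n, ω₂ n * ‖mFourierCoeff Θ₁ n‖) * ∫ x, ‖G x‖ ^ 2 := by
  classical
  have hM0 : 0 ≤ M := (abs_nonneg _).trans (hmM 0)
  -- the commutator estimate for the symbol `m²`
  have hm2 : ∀ k, |m k ^ 2| ≤ M ^ 2 := fun k => by
    rw [abs_pow]; exact pow_le_pow_left₀ (abs_nonneg _) (hmM k) 2
  obtain ⟨hRs, hR⟩ := sqrt_tsum_sq_commutator_le (m := fun k => m k ^ 2) hG hGs hΘ₁ hΘ₁s hm2 hω0 hω hωs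
  set H : UnitAddTorus d → ℂ := fourierSynth (fun k => ((m k ^ 2 : ℝ) : ℂ) * mFourierCoeff G k) with hH_def
  have hh : Summable fun k => ‖((m k ^ 2 : ℝ) : ℂ) * mFourierCoeff G k‖ :=
    (hGs.mul_left (M ^ 2)).of_nonneg_of_le (fun _ => norm_nonneg _) fun k => by
      rw [norm_mul, Complex.norm_real, Real.norm_eq_abs]
      exact mul_le_mul_of_nonneg_right (hm2 k) (norm_nonneg _)
  have hH_c : Continuous H := continuous_fourierSynth hh
  -- names for the three coefficient families
  set a : (d → ℤ) → ℂ := fun k => mFourierCoeff (fun x => Θ₁ x * G x) k with ha_def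
  set b : (d → ℤ) → ℂ := fun k => mFourierCoeff (fun x => Θ₂ x * G x) k with hb_def
  set p : (d → ℤ) → ℂ := fun k => mFourierCoeff (fun x => Θ₁ x * H x) k with hp_def
  set u : (d → ℤ) → ℂ := fun k => ((m k ^ 2 : ℝ) : ℂ) * a k - p k with hu_def
  have hParsb := hasSum_sq_mFourierCoeff_of_continuous (g := fun x => Θ₂ x * G x) (hΘ₂.mul hG)
  have hParsp := hasSum_sq_mFourierCoeff_of_continuous (g := fun x => Θ₁ x * H x) (hΘ₁.mul hH_c)
  have hParsG := hasSum_sq_mFourierCoeff_of_continuous hG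
  -- `∑ p conj(b) = 0` by disjointness
  have hpb_s : Summable fun k => p k * conj (b k) := (norm_tsum_mul_conj_le hParsp.summable hParsb.summable).1
  have hpb : ∑' k, p k * conj (b k) = 0 := by
    have h0 := tsum_conj_mFourierCoeff_mul_eq_zero_of_disjoint (H := G) (G := H) hΘ₂ hΘ₁ hG hH_c
      (fun x => by rw [← Complex.conj_conj (Θ₁ x), ← map_mul, mul_comm, hdis x, map_zero])
    -- `h0 : ∑ conj(𝓕(Θ₂G)) 𝓕(Θ₁H) = 0`
    have : ∑' k, p k * conj (b k) = ∑' k, conj (b k) * p k := tsum_congr fun k => mul_comm _ _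
    rw [this]
    exact h0
  -- split the sum
  obtain ⟨hub_s, hub⟩ := norm_tsum_mul_conj_le (u := u) (v := b) hRs hParsb.summable
  have hsum_eq : ∑' k, ((m k ^ 2 : ℝ) : ℂ) * a k * conj (b k) = ∑' k, u k * conj (b k) + ∑' k, p k * conj (b k) := by
    rw [← hub_s.tsum_add hpb_s]
    refine tsum_congr fun k => ?_
    rw [hu_def]
    ring
  rw [hsum_eq, hpb, add_zero]
  -- `‖b‖_{ℓ²} ≤ ‖G‖`, `‖u‖_{ℓ²} ≤ A₂ ‖G‖`
  have hb_le : Real.sqrt (∑' k, ‖b k‖ ^ 2) ≤ Real.sqrt (∫ x, ‖G x‖ ^ 2) := by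
    rw [hParsb.tsum_eq]
    refine Real.sqrt_le_sqrt ?_
    have := integral_norm_sq_mul_le hG hΘ₂1
    simpa using this
  have hint0 : 0 ≤ ∫ x, ‖G x‖ ^ 2 := integral_nonneg fun x => by positivity
  calc ‖∑' k, u k * conj (b k)‖ ≤ Real.sqrt (∑' k, ‖u k‖ ^ 2) * Real.sqrt (∑' k, ‖b k‖ ^ 2) := hub
    _ ≤ ((∑' n, ω₂ n * ‖mFourierCoeff Θ₁ n‖) * Real.sqrt (∫ x, ‖G x‖ ^ 2)) * Real.sqrt (∫ x, ‖G x‖ ^ 2) :=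
        mul_le_mul hR hb_le (Real.sqrt_nonneg _)
          (mul_nonneg (tsum_nonneg fun n => mul_nonneg (hω0 n) (norm_nonneg _)) (Real.sqrt_nonneg _))
    _ = (∑' n, ω₂ n * ‖mFourierCoeff Θ₁ n‖) * ∫ x, ‖G x‖ ^ 2 := by
        rw [mul_assoc, Real.mul_self_sqrt hint0]

end Summit.AnomalousDissipation.AnomalousDissipation.Theorems.SawtoothPulseCascade.SpectralLeakage
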